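import Summits.HodgeConjecture.CorCM.MultiFieldWeilFrameTransfer
import Summits.HodgeConjecture.CorCM.CMWeightPushforwardExtraction
import HarnessLib

/-!
# COR-CM — MULTI-FIELD WEIL, part 4: FRESH CURVE SLOTS in front of a product of copies, and the DESCENT of algebraicity along them
# (gen 21ʼs push-forward extraction, iterated one curve at a time)

Cell `pub-hodgecm2` (COR-CM), seat b30 gen 28 (2026-08-23); count-neutral own lane MULTI-FIELD WEIL ENGINE; sequel of
`CorCM/MultiFieldWeilFrameTransfer.lean`.  Theorems plus bookkeeping definitions (`Crd`, `vG`, `extE`/`extEN`, `upE`/`upEN`, `curvePt`, `upEmb`/`upENEmb`, `frPt`, `freshSide`);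
no named fact, no `sorry`.
SETTING: slots `mfSlots i₀ is : Fin (r+1) → I`, realisations `A j ⊨ (Kf (mfSlots i₀ is j); Φ j)` with `A 0 = E` the CM curve of `k = Kf i₀`
(`Hom(k, ℂ) = {τ, τ̄}`), a slot map `κ : Fin N → Fin (r+1)` and `X = ⨁_j A(κ j)`.

* §1 `vG e τ κ` — the model map of `X` (`(j, s) ↦ toPtG ⟨κ j, s⟩`); `extE κ = (0; κ)` — ONE fresh curve slot IN FRONT (`Fin.cons`, so that
  `X` is DEFINITIONALLY the sub-product of `X⁺ = E ⊞ X` on the slots `Fin.succ`), `extEN κ c` — `c` of them; the coordinate embeddings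
  `upE`, `upEN`; `vG_upEN` (the model map does not change);
* §2 the fresh coordinates: `curvePt τ b` (`τ` / `τ̄`), `freshSide is τ κ c b` — the `c` fresh coordinates over `τ_b` — their cardinality, model
  image, disjointness from the old coordinates;
* §3 **`descend_one`**, **`descend`** — if the weight line of `up(S) ⊔ (all 2c fresh coordinates)` on `X⁺ = E^c ⊞ X` is algebraic, so is the
  weight line of `S` on `X` (`CMWeights.weightClassesAlg_le_algebraicClasses_of_pushforward` along `Fin.succ`, `c` times; the complementary
  fresh weight is empty, degree `0`).
HONEST FRAMING: nothing about the Hodge conjecture is concluded here; `HC_CM` is not asserted.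
[cite: Schoen1998HodgeWeilAddendum, §10] [cite: Milne2020HodgeClassesAV, 1.2 (a)] [cite: MoonenZarhin1999LowDim, Thm. 0.2 and (2.8)]

## References
* [Schoen1998HodgeWeilAddendum] C. Schoen, Compositio Math. 114 (1998), §10.  [Milne2020HodgeClassesAV] J. S. Milne, arXiv:2010.08857, 1.2 (a).
  [MoonenZarhin1999LowDim] B. Moonen, Yu. Zarhin, Math. Ann. 315 (1999), Thm. 0.2, (2.8).
-/

noncomputable section

open CategoryTheory CategoryTheory.Limits NumberField

namespace Summit.HodgeConjecture.CorCM.MultiFieldWeil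

open Literature.AlgebraicGeometry Literature.AlgebraicGeometry.Motives Literature.AlgebraicGeometry.HodgeTheory
open Literature.AlgebraicGeometry.ComplexMultiplication (IsCMTypeRealisation)
open Literature.AlgebraicGeometry.Pohlmann1968
open Literature.AlgebraicTopology.SingularHomology
open Literature.NumberTheory.ComplexMultiplication
open Summit.HodgeConjecture.CorCM.Census.MultiFieldWeil
open Summit.HodgeConjecture.CorCM.CMWeights (sigma_map_injective weightClassesAlg_le_algebraicClasses_of_pushforward)

open scoped Classical Pointwise

/-! ## §1 The model map of a product of copies; fresh curve slots in front -/

section Fresh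

variable {I : Type} {r : ℕ} (Kf : I → Type) [∀ i, Field (Kf i)] (i₀ : I) (is : Fin r → I) {n : Fin r → ℕ}

/-- The index set (coordinates) of `X = ⨁_j A(κ j)`: pairs `(j, s)`, `s ∈ Hom(K_{κ j}, ℂ)`. [folklore] -/
abbrev Crd {N : ℕ} (κ : Fin N → Fin (r + 1)) : Type := (j : Fin N) × (Kf (mfSlots i₀ is (κ j)) →+* ℂ)

variable {Kf i₀ is}

/-- **The model map of `X = ⨁_j A(κ j)`**: `(j, s) ↦ toPtG (κ j, s)`. [folklore] -/
def vG (e : ∀ m : Fin r, (Kf (is m) →+* ℂ) ≃ Fin (n m) × Bool) (τ : Kf i₀ →+* ℂ) {N : ℕ} (κ : Fin N → Fin (r + 1)) :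
    Crd Kf i₀ is κ → PtG n := fun x => toPtG e τ ⟨κ x.1, x.2⟩

/-- `vG` is the model map composed with the slot projection `(j, s) ↦ (κ j, s)`. [folklore] -/
theorem vG_eq (e : ∀ m : Fin r, (Kf (is m) →+* ℂ) ≃ Fin (n m) × Bool) (τ : Kf i₀ →+* ℂ) {N : ℕ} (κ : Fin N → Fin (r + 1)) :
    vG e τ κ = fun x => toPtG e τ ((Sigma.map κ (fun _ => id) : Crd Kf i₀ is κ → ((l : Fin (r + 1)) × (Kf (mfSlots i₀ is l) →+* ℂ))) x) :=
  rfl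

variable {N : ℕ}

/-- **One fresh curve slot in front**: `extE κ = (0; κ)` (`Fin.cons`: `extE κ j.succ` is DEFINITIONALLY `κ j`). [folklore] -/
def extE (κ : Fin N → Fin (r + 1)) : Fin (N + 1) → Fin (r + 1) := Fin.cons 0 κ

/-- `extE κ 0 = 0` (the fresh slot is a curve slot). [folklore] -/
@[simp] theorem extE_zero (κ : Fin N → Fin (r + 1)) : extE κ 0 = 0 := rfl

/-- `extE κ j.succ = κ j`. [folklore] -/
@[simp] theorem extE_succ (κ : Fin N → Fin (r + 1)) (j : Fin N) : extE κ j.succ = κ j := rfl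

/-- **`c` fresh curve slots in front.** [folklore] -/
def extEN (κ : Fin N → Fin (r + 1)) : (c : ℕ) → (Fin (N + c) → Fin (r + 1))
  | 0 => κ
  | c + 1 => extE (extEN κ c)

/-- `extEN κ 0 = κ`. [folklore] -/
@[simp] theorem extEN_zero (κ : Fin N → Fin (r + 1)) : extEN κ 0 = κ := rfl

/-- `extEN κ (c+1) = extE (extEN κ c)`. [folklore] -/
theorem extEN_succ (κ : Fin N → Fin (r + 1)) (c : ℕ) : extEN κ (c + 1) = extE (extEN κ c) := rfl

/-- The old coordinates inside `X⁺ = E ⊞ X`. [folklore] -/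
def upE (κ : Fin N → Fin (r + 1)) : Crd Kf i₀ is κ → Crd Kf i₀ is (extE κ) :=
  Sigma.map Fin.succ fun _ => id

/-- `upE` is the map `(j, s) ↦ (j+1, s)`. [folklore] -/
theorem upE_apply (κ : Fin N → Fin (r + 1)) (x : Crd Kf i₀ is κ) : upE κ x = ⟨x.1.succ, x.2⟩ := rfl

/-- `upE` is injective. [folklore] -/
theorem upE_injective (κ : Fin N → Fin (r + 1)) : Function.Injective (upE (Kf := Kf) (i₀ := i₀) (is := is) κ) :=
  sigma_map_injective (K := fun l => Kf (mfSlots i₀ is (extE κ l))) Fin.succ (Fin.succ_injective _)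

/-- The old coordinates inside `X⁺ = E^c ⊞ X`. [folklore] -/
def upEN (κ : Fin N → Fin (r + 1)) : (c : ℕ) → (Crd Kf i₀ is κ → Crd Kf i₀ is (extEN κ c))
  | 0 => id
  | c + 1 => upE (extEN κ c) ∘ upEN κ c

/-- `upEN κ 0 = id`. [folklore] -/
@[simp] theorem upEN_zero (κ : Fin N → Fin (r + 1)) (x : Crd Kf i₀ is κ) : upEN κ 0 x = x := rfl

/-- `upEN κ (c+1) = upE ∘ upEN κ c`. [folklore] -/
theorem upEN_succ (κ : Fin N → Fin (r + 1)) (c : ℕ) (x : Crd Kf i₀ is κ) : upEN κ (c + 1) x = upE (extEN κ c) (upEN κ c x) := rfl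

/-- `upEN` is injective. [folklore] -/
theorem upEN_injective (κ : Fin N → Fin (r + 1)) : ∀ c : ℕ, Function.Injective (upEN (Kf := Kf) (i₀ := i₀) (is := is) κ c)
  | 0 => fun _ _ h => h
  | c + 1 => (upE_injective (extEN κ c)).comp (upEN_injective κ c)

variable (e : ∀ m : Fin r, (Kf (is m) →+* ℂ) ≃ Fin (n m) × Bool) (τ : Kf i₀ →+* ℂ)

/-- **The model map does not change along `upE`.** [folklore] -/
@[simp] theorem vG_upE (κ : Fin N → Fin (r + 1)) (x : Crd Kf i₀ is κ) : vG e τ (extE κ) (upE κ x) = vG e τ κ x := rfl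

/-- **The model map does not change along `upEN`.** [folklore] -/
theorem vG_upEN (κ : Fin N → Fin (r + 1)) : ∀ (c : ℕ) (x : Crd Kf i₀ is κ), vG e τ (extEN κ c) (upEN κ c x) = vG e τ κ x
  | 0, _ => rfl
  | c + 1, x => by
    show vG e τ (extE (extEN κ c)) (upE (extEN κ c) (upEN κ c x)) = vG e τ κ x
    rw [vG_upE]
    exact vG_upEN κ c x

/-- **Fibre counts do not change along an embedding compatible with the model maps.** [folklore] -/
theorem cnt_map_eq {α β : Type*} {v : α → PtG n} {v' : β → PtG n} (f : α ↪ β) (hf : ∀ x, v' (f x) = v x) (S : Finset α) (y : PtG n) :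
    cnt v' (S.map f) y = cnt v S y := by
  rw [cnt, cnt, Finset.filter_map, Finset.card_map]
  congr 1
  ext x
  simp only [Finset.mem_filter, Function.comp_apply, hf]

end Fresh

/-! ## §2 The fresh coordinates -/

section FreshCoords

variable {I : Type} {r : ℕ} {Kf : I → Type} [∀ i, Field (Kf i)] {i₀ : I} {is : Fin r → I} {n : Fin r → ℕ} {N : ℕ}
  (e : ∀ m : Fin r, (Kf (is m) →+* ℂ) ≃ Fin (n m) × Bool) (τ : Kf i₀ →+* ℂ)

/-- The two embeddings of `k`: `curvePt τ true = τ`, `curvePt τ false = τ̄`. [folklore] -/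
def curvePt (τ : Kf i₀ →+* ℂ) : Bool → (Kf i₀ →+* ℂ)
  | true => τ
  | false => ComplexEmbedding.conjugate τ

/-- `curvePt τ true = τ`. [folklore] -/
@[simp] theorem curvePt_true : curvePt τ true = τ := rfl

/-- `curvePt τ false = τ̄`. [folklore] -/
@[simp] theorem curvePt_false : curvePt τ false = ComplexEmbedding.conjugate τ := rfl

variable {τ} (hττ : ComplexEmbedding.conjugate τ ≠ τ) (hk : ∀ σ : Kf i₀ →+* ℂ, σ = τ ∨ σ = ComplexEmbedding.conjugate τ)

include hττ in
/-- `[curvePt τ b = τ] = b`. [folklore] -/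
theorem decide_curvePt_eq (b : Bool) : decide (curvePt τ b = τ) = b := by
  cases b
  · exact decide_eq_false hττ
  · exact decide_eq_true rfl

include hk in
/-- Every embedding of `k` is a `curvePt`. [folklore] -/
theorem exists_curvePt_eq (σ : Kf i₀ →+* ℂ) : ∃ b, curvePt τ b = σ := by
  rcases hk σ with rfl | rfl
  · exact ⟨true, rfl⟩
  · exact ⟨false, rfl⟩

variable (is) in
/-- The coordinate embedding `E^c ⊞ X ↪ E^{c+1} ⊞ X` (typed at level `c + 1`). [folklore] -/
def upEmb (κ : Fin N → Fin (r + 1)) (c : ℕ) : Crd Kf i₀ is (extEN κ c) ↪ Crd Kf i₀ is (extEN κ (c + 1)) :=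
  ⟨upE (extEN κ c), upE_injective (extEN κ c)⟩

variable (is) in
/-- The coordinate embedding `X ↪ E^c ⊞ X`. [folklore] -/
def upENEmb (κ : Fin N → Fin (r + 1)) (c : ℕ) : Crd Kf i₀ is κ ↪ Crd Kf i₀ is (extEN κ c) := ⟨upEN κ c, upEN_injective κ c⟩

/-- `upEmb` is `upE`. [folklore] -/
theorem upEmb_apply (κ : Fin N → Fin (r + 1)) (c : ℕ) (y : Crd Kf i₀ is (extEN κ c)) : upEmb is κ c y = upE (extEN κ c) y := rfl

/-- `upENEmb κ 0` is the identity. [folklore] -/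
@[simp] theorem upENEmb_zero_apply (κ : Fin N → Fin (r + 1)) (x : Crd Kf i₀ is κ) : upENEmb is κ 0 x = x := rfl

/-- `upENEmb κ (c+1) = upEmb κ c ∘ upENEmb κ c` on finsets. [folklore] -/
theorem map_upENEmb_succ (κ : Fin N → Fin (r + 1)) (c : ℕ) (S : Finset (Crd Kf i₀ is κ)) :
    S.map (upENEmb is κ (c + 1)) = (S.map (upENEmb is κ c)).map (upEmb is κ c) := by
  rw [Finset.map_map]; rfl

/-- The model map does not change along `upEmb`. [folklore] -/
@[simp] theorem vG_upEmb (κ : Fin N → Fin (r + 1)) (c : ℕ) (y : Crd Kf i₀ is (extEN κ c)) :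
    vG e τ (extEN κ (c + 1)) (upEmb is κ c y) = vG e τ (extEN κ c) y := rfl

/-- The model map does not change along `upENEmb`. [folklore] -/
@[simp] theorem vG_upENEmb (κ : Fin N → Fin (r + 1)) (c : ℕ) (x : Crd Kf i₀ is κ) :
    vG e τ (extEN κ c) (upENEmb is κ c x) = vG e τ κ x := vG_upEN e τ κ c x

variable (is τ) in
/-- **The fresh coordinate of `E^{c+1} ⊞ X` over `τ_b`** (on the new curve, slot `0`; typed at level `c + 1`). [folklore] -/
def frPt (κ : Fin N → Fin (r + 1)) (c : ℕ) (b : Bool) : Crd Kf i₀ is (extEN κ (c + 1)) := ⟨(0 : Fin (N + c + 1)), curvePt τ b⟩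

/-- The slot of the fresh coordinate is `0`. [folklore] -/
theorem frPt_fst (κ : Fin N → Fin (r + 1)) (c : ℕ) (b : Bool) : (frPt is τ κ c b).1 = (0 : Fin (N + c + 1)) := rfl

include hττ in
/-- **The fresh coordinate over `τ_b` lies over the model point `inl b`.** [folklore] -/
@[simp] theorem vG_frPt (κ : Fin N → Fin (r + 1)) (c : ℕ) (b : Bool) : vG e τ (extEN κ (c + 1)) (frPt is τ κ c b) = Sum.inl b := by
  show toPtG e τ ⟨0, curvePt τ b⟩ = _
  rw [toPtG_zero]
  congr 1
  exact decide_curvePt_eq hττ b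

/-- A fresh coordinate is not an old one. [folklore] -/
theorem frPt_ne_upEmb (κ : Fin N → Fin (r + 1)) (c : ℕ) (b : Bool) (y : Crd Kf i₀ is (extEN κ c)) : frPt is τ κ c b ≠ upEmb is κ c y :=
  fun h => Fin.succ_ne_zero y.1 (congrArg Sigma.fst h).symm

/-- A fresh coordinate is not in the image of the old ones. [folklore] -/
theorem frPt_not_mem_map (κ : Fin N → Fin (r + 1)) (c : ℕ) (b : Bool) (S : Finset (Crd Kf i₀ is (extEN κ c))) :
    frPt is τ κ c b ∉ S.map (upEmb is κ c) := fun h => by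
  obtain ⟨y, -, hy⟩ := Finset.mem_map.1 h
  exact frPt_ne_upEmb κ c b y hy.symm

include hττ in
/-- The two fresh coordinates of the new curve are distinct. [folklore] -/
theorem frPt_true_ne_false (κ : Fin N → Fin (r + 1)) (c : ℕ) : frPt is τ κ c true ≠ frPt is τ κ c false := fun h =>
  hττ (eq_of_heq (Sigma.mk.inj_iff.1 h).2).symm

variable (is τ) in
/-- **The `c` fresh coordinates over `τ_b`** of `X⁺ = E^c ⊞ X` (one on each fresh curve). [folklore] -/
def freshSide (κ : Fin N → Fin (r + 1)) : (c : ℕ) → Bool → Finset (Crd Kf i₀ is (extEN κ c))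
  | 0, _ => ∅
  | c + 1, b => insert (frPt is τ κ c b) ((freshSide κ c b).map (upEmb is κ c))

/-- `freshSide κ 0 b = ∅`. [folklore] -/
@[simp] theorem freshSide_zero (κ : Fin N → Fin (r + 1)) (b : Bool) : freshSide is τ κ 0 b = ∅ := rfl

/-- The recursion of `freshSide`. [folklore] -/
theorem freshSide_succ (κ : Fin N → Fin (r + 1)) (c : ℕ) (b : Bool) :
    freshSide is τ κ (c + 1) b = insert (frPt is τ κ c b) ((freshSide is τ κ c b).map (upEmb is κ c)) := rfl

include hττ in
/-- **The fresh coordinates over `τ_b` lie over the model point `inl b`.** [folklore] -/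
theorem vG_of_mem_freshSide (κ : Fin N → Fin (r + 1)) :
    ∀ (c : ℕ) (b : Bool) {x : Crd Kf i₀ is (extEN κ c)}, x ∈ freshSide is τ κ c b → vG e τ (extEN κ c) x = Sum.inl b
  | 0, _, _, hx => absurd hx (Finset.notMem_empty _)
  | c + 1, b, x, hx => by
    rw [freshSide_succ, Finset.mem_insert, Finset.mem_map] at hx
    rcases hx with rfl | ⟨y, hy, rfl⟩
    · exact vG_frPt e hττ κ c b
    · rw [vG_upEmb]
      exact vG_of_mem_freshSide κ c b hy

/-- **There are `c` fresh coordinates over `τ_b`.** [folklore] -/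
theorem card_freshSide (κ : Fin N → Fin (r + 1)) : ∀ (c : ℕ) (b : Bool), (freshSide is τ κ c b).card = c
  | 0, _ => rfl
  | c + 1, b => by
    rw [freshSide_succ, Finset.card_insert_of_notMem (frPt_not_mem_map κ c b _), Finset.card_map, card_freshSide κ c b]

include hττ in
/-- The fresh coordinates over `τ` and over `τ̄` are disjoint. [folklore] -/
theorem disjoint_freshSide (κ : Fin N → Fin (r + 1)) : ∀ c : ℕ, Disjoint (freshSide is τ κ c true) (freshSide is τ κ c false)
  | 0 => Finset.disjoint_empty_left _
  | c + 1 => Finset.disjoint_left.2 fun x hx hx' => by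
    rw [freshSide_succ, Finset.mem_insert, Finset.mem_map] at hx hx'
    rcases hx with rfl | ⟨y, hy, rfl⟩ <;> rcases hx' with h | ⟨y', hy', h⟩
    · exact frPt_true_ne_false hττ κ c h
    · exact frPt_ne_upEmb κ c true y' h.symm
    · exact frPt_ne_upEmb κ c false y h.symm
    · exact Finset.disjoint_left.1 (disjoint_freshSide κ c) hy ((upEmb is κ c).injective h ▸ hy')

/-- **The fresh coordinates are disjoint from the old ones.** [folklore] -/
theorem disjoint_freshSide_map (κ : Fin N → Fin (r + 1)) :
    ∀ (c : ℕ) (b : Bool) (S : Finset (Crd Kf i₀ is κ)), Disjoint (freshSide is τ κ c b) (S.map (upENEmb is κ c))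
  | 0, _, _ => Finset.disjoint_empty_left _
  | c + 1, b, S => by
    rw [freshSide_succ, Finset.disjoint_insert_left, map_upENEmb_succ]
    refine ⟨frPt_not_mem_map κ c b _, ?_⟩
    rw [Finset.disjoint_map]
    exact disjoint_freshSide_map κ c b S

end FreshCoords

/-! ## §3 Descent of algebraicity along the fresh curve slots -/

section Descent

variable {I : Type} {r : ℕ} {Kf : I → Type} [∀ i, Field (Kf i)] [∀ i, NumberField (Kf i)] {i₀ : I} {is : Fin r → I} {n : Fin r → ℕ}
  {N : ℕ} {e : ∀ m : Fin r, (Kf (is m) →+* ℂ) ≃ Fin (n m) × Bool} {τ : Kf i₀ →+* ℂ}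
  (hττ : ComplexEmbedding.conjugate τ ≠ τ) (hk : ∀ σ : Kf i₀ →+* ℂ, σ = τ ∨ σ = ComplexEmbedding.conjugate τ)
  {A : Fin (r + 1) → AbelianVariety ℂ} {Φ : ∀ j : Fin (r + 1), CMType (Kf (mfSlots i₀ is j))}
  {ι : ∀ j, 𝓞 (Kf (mfSlots i₀ is j)) →+* End (A j)}
  {θ : ∀ j, Kf (mfSlots i₀ is j) →+* Module.End ℂ (complexBetti (A j).X 1)}
  (hA : ∀ j, IsCMTypeRealisation (Φ j) (A j) (ι j) (θ j))

include hττ hk hA in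
/-- **Descent along ONE fresh curve.**  If the weight line of `up(S) ⊔ {(0,τ), (0,τ̄)}` on `X⁺ = E ⊞ X` consists of algebraic classes, so
does the weight line of `S` on `X` — gen 21ʼs push-forward extraction along `π : X⁺ → X` (the sub-product on the slots `Fin.succ`; the
complementary fresh weight is empty). [cite: Schoen1998HodgeWeilAddendum, §10] [cite: Milne2020HodgeClassesAV, 1.2 (a)] -/
theorem descend_one (κ : Fin N → Fin (r + 1)) {p : ℕ} {S : Finset (Crd Kf i₀ is κ)} (hS : S.card = 2 * p)
    (h : weightClassesAlg (fun l => A (extE κ l)) (fun l => ι (extE κ l)) (2 * (p + 1))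
      (S.map ⟨upE κ, upE_injective κ⟩ ∪ {(⟨0, τ⟩ : Crd Kf i₀ is (extE κ)), (⟨0, ComplexEmbedding.conjugate τ⟩ : Crd Kf i₀ is (extE κ))}) ≤
      algebraicClasses (⨁ fun l => A (extE κ l)).X (p + 1)) :
    weightClassesAlg (fun j => A (κ j)) (fun j => ι (κ j)) (2 * p) S ≤ algebraicClasses (⨁ fun j => A (κ j)).X p := by
  have hAe : ∀ l, IsCMTypeRealisation (Φ (extE κ l)) (A (extE κ l)) (ι (extE κ l)) (θ (extE κ l)) := fun l => hA (extE κ l)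
  have hne : (⟨0, τ⟩ : Crd Kf i₀ is (extE κ)) ≠ (⟨0, ComplexEmbedding.conjugate τ⟩ : Crd Kf i₀ is (extE κ)) := fun hh => by
    have h2 := (Sigma.mk.inj_iff.1 hh).2
    exact hττ (eq_of_heq h2).symm
  have hT : ({(⟨0, τ⟩ : Crd Kf i₀ is (extE κ)), (⟨0, ComplexEmbedding.conjugate τ⟩ : Crd Kf i₀ is (extE κ))} : Finset _).card = 2 * 1 := Finset.card_pair hne
  have hT' : (∅ : Finset (Crd Kf i₀ is (extE κ))).card = 2 * 0 := rfl
  have hTT' : Disjoint ({(⟨0, τ⟩ : Crd Kf i₀ is (extE κ)), (⟨0, ComplexEmbedding.conjugate τ⟩ : Crd Kf i₀ is (extE κ))} : Finset _) ∅ :=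
    Finset.disjoint_empty_right _
  have hcov : ∀ x : Crd Kf i₀ is (extE κ),
      (x ∈ ({(⟨0, τ⟩ : Crd Kf i₀ is (extE κ)), (⟨0, ComplexEmbedding.conjugate τ⟩ : Crd Kf i₀ is (extE κ))} : Finset _) ∨ x ∈ (∅ : Finset _)) ↔
        x.1 ∉ Set.range (Fin.succ : Fin N → Fin (N + 1)) := by
    intro x
    simp only [Finset.notMem_empty, or_false, Finset.mem_insert, Finset.mem_singleton, Set.mem_range, not_exists]
    constructor
    · rintro (rfl | rfl) j hj <;> exact Fin.succ_ne_zero j hj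
    · intro hx
      obtain ⟨l, s⟩ := x
      have hl : l = 0 := by
        rcases Fin.eq_zero_or_eq_succ l with h0 | ⟨j, rfl⟩
        · exact h0
        · exact absurd rfl (hx j)
      subst hl
      rcases hk s with rfl | rfl
      · exact Or.inl rfl
      · exact Or.inr rfl
  have halg₂ : weightClassesAlg (fun l => A (extE κ l)) (fun l => ι (extE κ l)) (2 * 0) (∅ : Finset (Crd Kf i₀ is (extE κ))) ≤
      algebraicClasses (⨁ fun l => A (extE κ l)).X 0 := fun c' _ => hodgeConjectureFor_codim_zero c'
  exact weightClassesAlg_le_algebraicClasses_of_pushforward (K := fun l => Kf (mfSlots i₀ is (extE κ l))) hAe Fin.succ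
    (Fin.succ_injective _) hS hT hT' hTT' hcov h halg₂

include hττ hk hA in
/-- **Descent along `c` fresh curves.**  If the weight line of `up(S) ⊔ (all 2c fresh coordinates)` on `X⁺ = E^c ⊞ X` consists of algebraic
classes, so does the weight line of `S` on `X` (`descend_one`, `c` times). [cite: Schoen1998HodgeWeilAddendum, §10]
[cite: Milne2020HodgeClassesAV, 1.2 (a)] -/
theorem descend (κ : Fin N → Fin (r + 1)) : ∀ (c : ℕ) {p : ℕ} {S : Finset (Crd Kf i₀ is κ)}, S.card = 2 * p →
    weightClassesAlg (fun l => A (extEN κ c l)) (fun l => ι (extEN κ c l)) (2 * (p + c))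
      (S.map (upENEmb is κ c) ∪ (freshSide is τ κ c true ∪ freshSide is τ κ c false)) ≤
      algebraicClasses (⨁ fun l => A (extEN κ c l)).X (p + c) →
    weightClassesAlg (fun j => A (κ j)) (fun j => ι (κ j)) (2 * p) S ≤ algebraicClasses (⨁ fun j => A (κ j)).X p
  | 0, p, S, hS, h => by
    have hS' : S.map (upENEmb is κ 0) ∪ (freshSide is τ κ 0 true ∪ freshSide is τ κ 0 false) = S := by
      rw [freshSide_zero, freshSide_zero, Finset.union_empty, Finset.union_empty]
      ext x
      simp only [Finset.mem_map, upENEmb_zero_apply]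
      constructor
      · rintro ⟨a, ha, rfl⟩; exact ha
      · intro hx; exact ⟨x, hx, rfl⟩
    rw [hS'] at h
    exact h
  | c + 1, p, S, hS, h => by
    -- the weight on `E^c ⊞ X`
    have hS₁ : (S.map (upENEmb is κ c) ∪ (freshSide is τ κ c true ∪ freshSide is τ κ c false)).card = 2 * (p + c) := by
      rw [Finset.card_union_of_disjoint (Finset.disjoint_union_right.2
        ⟨(disjoint_freshSide_map κ c true S).symm, (disjoint_freshSide_map κ c false S).symm⟩), Finset.card_map, hS,
        Finset.card_union_of_disjoint (disjoint_freshSide hττ κ c), card_freshSide, card_freshSide]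
      ring
    refine descend κ c hS (descend_one hττ hk hA (extEN κ c) hS₁ ?_)
    -- the two presentations of the weight on `E ⊞ E^c ⊞ X` agree
    have key : (S.map (upENEmb is κ c) ∪ (freshSide is τ κ c true ∪ freshSide is τ κ c false)).map
          ⟨upE (extEN κ c), upE_injective (extEN κ c)⟩ ∪
          {(⟨0, τ⟩ : Crd Kf i₀ is (extE (extEN κ c))), (⟨0, ComplexEmbedding.conjugate τ⟩ : Crd Kf i₀ is (extE (extEN κ c)))} =
        S.map (upENEmb is κ (c + 1)) ∪ (freshSide is τ κ (c + 1) true ∪ freshSide is τ κ (c + 1) false) := by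
      show (S.map (upENEmb is κ c) ∪ (freshSide is τ κ c true ∪ freshSide is τ κ c false)).map (upEmb is κ c) ∪
          {frPt is τ κ c true, frPt is τ κ c false} = _
      rw [freshSide_succ, freshSide_succ, map_upENEmb_succ, Finset.map_union, Finset.map_union]
      ext x
      simp only [Finset.mem_union, Finset.mem_insert, Finset.mem_singleton]
      tauto
    rw [key]
    have hpc : p + c + 1 = p + (c + 1) := Nat.add_assoc p c 1
    rw [hpc]
    exact h

end Descent

end Summit.HodgeConjecture.CorCM.MultiFieldWeil

end
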